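import Summits.AtomisticToContinuum.HydrodynamicLimit.Theorems.RelayRaceLocalityNearConstantShortTimeHLFluxRemainderB
import Summits.AtomisticToContinuum.HydrodynamicLimit.Theorems.RelayRaceLocalityNearConstantShortTimeHLFieldBounds
import Summits.AtomisticToContinuum.HydrodynamicLimit.Theorems.RelayRaceLocalityNearConstantShortTimeHLSolutionTests
import HarnessLib

/-!
# Crux `NearConstantShortTimeHL` (stmt-AtomisticToContinuum-12502), line `small-tilt-domination`:
# the stub `integral_abs_ballRate_sub_eulerRate_le` (the flux-remainder integral bound)

Lead c3, wave 2. Along a classical hard-sphere Euler solution `(ρ, u, θ)` on `[0, T) × 𝕋³` with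
packing `ρσ³ < η₀` on `[0, t] × 𝕋³` (analytic low-density equation of state on `[0, η₀)`), the
entropy-rate density `Θ_r(x)` evaluated at the ball averages `(ρ̃, m̃, ẽ)` of a configuration
`w` (`ballRate`) and at the Euler state (`eulerRate`) satisfy, for every configuration obeying the
ball-packing cap `ρ̃σ³ ≤ η₁ < η₀`,
`∫ |ballRate_r − eulerRate_r| dx ≤ C (1 + L) · fluctuationE_r(w) + C · cubicTail_L(w)`
with `C` depending on the solution data only (`r ∈ [0, t]`, `0 < ℓ < 1/2`, `L ≥ 1`).

Proof. GOOD centres `x` (deviation `|ρ̃−ρ| + ‖m̃−ρu‖ + |ẽ−E| ≤ c₀ ≤ 1`): Dafermos' quadratic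
remainder (`entropyFlux_remainder_bound`, landed; its left-hand side is literally
`ballRate − eulerRate` by `entropyRate_sub_eulerRate_eq`) gives `≤ C_B dev²` and
`dev² = min(1, dev²) ≤ (1 + ρ̃ + ẽ) min(1, dev²)`. BAD centres: `min(1, dev²) ≥ min(1, c₀²/3)`
prices the crude sizes `|ballRate| ≤ Λ(25 + 6Z_m)(ρ̃ + ẽ + c̃)` (`wb_abs_ballRate_le`),
`|eulerRate| ≤ C_E` (`wb_abs_eulerRate_le`), `c̃ ≤ 2Lẽ + n⁻¹Σ kᵢ‖vᵢ‖³𝟙{‖vᵢ‖ > L}`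
(`ballCubic_le_trunc`); the tail integrates to `cubicTail` (`integral_ballAverage_eq`). The
coefficient bound `Λ` and the sizes of `ρ, u, θ, Z(ρσ³)` on `[0, t] × 𝕋³` come from the joint
smoothness of the log-profile rows on a slab `[0, T') ⊃ [0, t]` (`wb_coeffs`, `wb_solution_bounds`);
integrability in `x` is measurability (finite sums of ball indicators, continuous coefficients)
plus these bounds. No definitions, no named facts.

References: H.-T. Yau, Lett. Math. Phys. 22 (1991) §2; C. M. Dafermos, *Hyperbolic Conservation
Laws in Continuum Physics* (2005), Thm 5.2.1.
-/

noncomputable section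

namespace Summit.AtomisticToContinuum.HydrodynamicLimit.Theorems.NearConstantShortTimeHL

open scoped BigOperators ENNReal
open MeasureTheory Set Filter
open Literature.MathematicalPhysics.KineticTheory Literature.Analysis.FluidPDE Literature.Analysis.FunctionSpaces
open Summit.AtomisticToContinuum.HydrodynamicLimit.Theorems.EntropicWeakStrong

/-! ### Uniform data of the solution on `[0, t] × 𝕋³` -/

/-- **Coefficient bounds and measurability.** Along a classical solution with packing `< η₀` on
`[0, t] × 𝕋³` the six coefficient families `∂ₜλ⁰, ∂ₜλ, ∂ₜλ⁴, ∂ₖλ⁰, ∂ₖλ, ∂ₖλ⁴` of the entropy rate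
(one-sided time derivatives within `[0, T)`) are bounded by one `Λ` on `[0, t] × 𝕋³` and their
slices are measurable in `x`: the rows are jointly smooth on a slab `[0, T') ⊇ [0, t]`
(`isSmoothSpaceTimeOn_logProfileRows`, `exists_horizon_of_packing_lt`), so are their derivatives
(`IsSmoothSpaceTimeOn.timeDerivWithin/partialDeriv`), and the time derivatives within `[0, T)`
and `[0, T')` agree (`timeDerivWithin_Ico_eq_of_le`). [folklore] -/
theorem wb_coeffs {η₀ : ℝ} {F : ℝ → ℝ} (hη₀ : 0 < η₀) (hFa : AnalyticOnNhd ℝ F (Set.Ioo (-η₀) η₀))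
    (hF : Set.EqOn hsExcessFreeEnergy F (Set.Ico 0 η₀)) {σ T : ℝ} (hσ : 0 < σ)
    {ρ θ : ℝ → T3 → ℝ} {u : ℝ → T3 → V3} (hE : IsHardSphereEulerSolution σ T ρ u θ) {t : ℝ}
    (ht : t ∈ Set.Ico 0 T) (hpack : ∀ s ∈ Set.Icc 0 t, ∀ x, ρ s x * σ ^ 3 < η₀) :
    ∃ Λ : ℝ, 0 < Λ ∧ ∀ r ∈ Set.Icc 0 t,
      (∀ x, |Torus.timeDerivWithin (Set.Ico 0 T) (lam0Row σ ρ θ u) r x| ≤ Λ ∧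
        (∀ j, |Torus.timeDerivWithin (Set.Ico 0 T) (lamRow θ u) r x j| ≤ Λ) ∧
        |Torus.timeDerivWithin (Set.Ico 0 T) (lam4Row θ) r x| ≤ Λ ∧
        (∀ k, |Torus.partialDeriv k (lam0Row σ ρ θ u r) x| ≤ Λ) ∧
        (∀ k j, |Torus.partialDeriv k (lamRow θ u r) x j| ≤ Λ) ∧
        (∀ k, |Torus.partialDeriv k (lam4Row θ r) x| ≤ Λ)) ∧
      Measurable (fun x => Torus.timeDerivWithin (Set.Ico 0 T) (lam0Row σ ρ θ u) r x) ∧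
      Measurable (fun x => Torus.timeDerivWithin (Set.Ico 0 T) (lamRow θ u) r x) ∧
      Measurable (fun x => Torus.timeDerivWithin (Set.Ico 0 T) (lam4Row θ) r x) ∧
      (∀ k, Measurable fun x => Torus.partialDeriv k (lam0Row σ ρ θ u r) x) ∧
      (∀ k, Measurable fun x => Torus.partialDeriv k (lamRow θ u r) x) ∧
      (∀ k, Measurable fun x => Torus.partialDeriv k (lam4Row θ r) x) := by
  obtain ⟨T', htT', hT'T, hpack'⟩ := exists_horizon_of_packing_lt hE hσ ht hpack
  obtain ⟨s0, s1, s4⟩ := isSmoothSpaceTimeOn_logProfileRows hη₀ hFa hF hσ hE hT'T hpack'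
  have r0 : Torus.IsSmoothSpaceTimeOn (Set.Ico 0 T') (lam0Row σ ρ θ u) := s0
  have r1 : Torus.IsSmoothSpaceTimeOn (Set.Ico 0 T') (lamRow θ u) := s1
  have r4 : Torus.IsSmoothSpaceTimeOn (Set.Ico 0 T') (lam4Row θ) := s4
  have hU : UniqueDiffOn ℝ (Set.Ico (0 : ℝ) T') := uniqueDiffOn_Ico 0 T'
  have hsub : Set.Icc 0 t ⊆ Set.Ico 0 T' := Set.Icc_subset_Ico_right htT'
  obtain ⟨⟨Λ0, hΛ0, hb0, -⟩, -⟩ := exists_bounds_moduli_of_isSmoothSpaceTimeOn r0 ht.1 htT'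
  obtain ⟨⟨Λ1, hΛ1, hb1, -⟩, -⟩ := exists_bounds_moduli_of_isSmoothSpaceTimeOn r1 ht.1 htT'
  obtain ⟨⟨Λ4, hΛ4, hb4, -⟩, -⟩ := exists_bounds_moduli_of_isSmoothSpaceTimeOn r4 ht.1 htT'
  refine ⟨Λ0 + Λ1 + Λ4, by positivity, fun r hr => ?_⟩
  have hr' : r ∈ Set.Ico 0 T' := hsub hr
  have hvj : ∀ (v : V3) (j : Fin 3), |v j| ≤ ‖v‖ := fun v j => by
    have h := PiLp.norm_apply_le v j
    rwa [Real.norm_eq_abs] at h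
  have e0 : (fun x => Torus.timeDerivWithin (Set.Ico 0 T) (lam0Row σ ρ θ u) r x) =
      fun x => Torus.timeDerivWithin (Set.Ico 0 T') (lam0Row σ ρ θ u) r x :=
    funext fun x => (timeDerivWithin_Ico_eq_of_le hT'T _ hr' x).symm
  have e1 : (fun x => Torus.timeDerivWithin (Set.Ico 0 T) (lamRow θ u) r x) =
      fun x => Torus.timeDerivWithin (Set.Ico 0 T') (lamRow θ u) r x :=
    funext fun x => (timeDerivWithin_Ico_eq_of_le hT'T _ hr' x).symm
  have e4 : (fun x => Torus.timeDerivWithin (Set.Ico 0 T) (lam4Row θ) r x) =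
      fun x => Torus.timeDerivWithin (Set.Ico 0 T') (lam4Row θ) r x :=
    funext fun x => (timeDerivWithin_Ico_eq_of_le hT'T _ hr' x).symm
  refine ⟨fun x => ⟨?_, fun j => ?_, ?_, fun k => ?_, fun k j => ?_, fun k => ?_⟩,
    ?_, ?_, ?_, fun k => ?_, fun k => ?_, fun k => ?_⟩
  · rw [← timeDerivWithin_Ico_eq_of_le hT'T _ hr' x, ← Real.norm_eq_abs]
    linarith [(hb0 r hr x).2.1]
  · rw [← timeDerivWithin_Ico_eq_of_le hT'T _ hr' x]
    linarith [(hvj _ j).trans (hb1 r hr x).2.1]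
  · rw [← timeDerivWithin_Ico_eq_of_le hT'T _ hr' x, ← Real.norm_eq_abs]
    linarith [(hb4 r hr x).2.1]
  · rw [← Real.norm_eq_abs]
    linarith [(hb0 r hr x).2.2 k]
  · linarith [(hvj _ j).trans ((hb1 r hr x).2.2 k)]
  · rw [← Real.norm_eq_abs]
    linarith [(hb4 r hr x).2.2 k]
  · rw [e0]; exact ((r0.timeDerivWithin hU).isSmooth_slice hr').continuous.measurable
  · rw [e1]; exact ((r1.timeDerivWithin hU).isSmooth_slice hr').continuous.measurable
  · rw [e4]; exact ((r4.timeDerivWithin hU).isSmooth_slice hr').continuous.measurable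
  · exact ((r0.partialDeriv hU k).isSmooth_slice hr').continuous.measurable
  · exact ((r1.partialDeriv hU k).isSmooth_slice hr').continuous.measurable
  · exact ((r4.partialDeriv hU k).isSmooth_slice hr').continuous.measurable

/-- **Size of the Euler fields and of the compressibility factor.** Along a classical solution
with packing `< η₀` on `[0, t] × 𝕋³` there are `L ≥ 1` and `Z_m ≥ 0` with `0 < ρ ≤ L`,
`‖u‖ ≤ L`, `0 < θ ≤ L` on `[0, t] × 𝕋³`, and `|Z| ≤ Z_m` both on `[0, η₁]` (`η₁ < η₀`, the
ball-packing cap) and at the packing `ρσ³` of the solution (continuity on compacts;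
`exists_packing_interval`, `wb_exists_compressibility_bound`). [folklore] -/
theorem wb_solution_bounds {η₀ : ℝ} {F : ℝ → ℝ} (hη₀ : 0 < η₀)
    (hFa : AnalyticOnNhd ℝ F (Set.Ioo (-η₀) η₀)) (hF : Set.EqOn hsExcessFreeEnergy F (Set.Ico 0 η₀))
    {σ T : ℝ} (hσ : 0 < σ) {ρ θ : ℝ → T3 → ℝ} {u : ℝ → T3 → V3}
    (hE : IsHardSphereEulerSolution σ T ρ u θ) {t : ℝ} (ht : t ∈ Set.Ico 0 T)
    (hpack : ∀ s ∈ Set.Icc 0 t, ∀ x, ρ s x * σ ^ 3 < η₀) {η₁ : ℝ} (hη₁₀ : η₁ < η₀) :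
    ∃ L : ℝ, 1 ≤ L ∧ ∃ Zm : ℝ, 0 ≤ Zm ∧ (∀ η ∈ Set.Icc 0 η₁, |hsCompressibility η| ≤ Zm) ∧
      ∀ r ∈ Set.Icc 0 t, ∀ x, 0 < ρ r x ∧ 0 < θ r x ∧ ρ r x ≤ L ∧ ‖u r x‖ ≤ L ∧ θ r x ≤ L ∧
        |hsCompressibility (ρ r x * σ ^ 3)| ≤ Zm := by
  obtain ⟨T', htT', hT'T, hpack'⟩ := exists_horizon_of_packing_lt hE hσ ht hpack
  have hE' : IsHardSphereEulerSolution σ T' ρ u θ := hE.restrict hT'T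
  have ht' : t ∈ Ico 0 T' := ⟨ht.1, htT'⟩
  have hsub : Icc 0 t ⊆ Ico 0 T' := Icc_subset_Ico_right htT'
  obtain ⟨y₁, y₂, -, hy₂, hρI, -⟩ := exists_packing_interval hE' hpack' ht'
    (isCompact_empty : IsCompact (∅ : Set (ℝ × V3 × ℝ))) (empty_subset _)
  obtain ⟨Cu, hCu⟩ := hE'.smooth_velocity.exists_norm_le_of_isCompact isCompact_Icc hsub
  obtain ⟨Cθ, hCθ⟩ := hE'.smooth_temperature.exists_norm_le_of_isCompact isCompact_Icc hsub
  obtain ⟨Zm, hZm0, hZm⟩ := wb_exists_compressibility_bound hη₀ hFa hF (max_lt hη₁₀ hy₂)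
  refine ⟨max (max 1 y₂) (max Cu Cθ), le_max_of_le_left (le_max_left _ _), Zm, hZm0,
    fun η hη => hZm η ⟨hη.1, hη.2.trans (le_max_left _ _)⟩, fun r hr x => ?_⟩
  have hrT' : r ∈ Ico 0 T' := hsub hr
  have hσ3 : 0 < σ ^ 3 := pow_pos hσ 3
  refine ⟨hE'.density_pos r hrT' x, hE'.temperature_pos r hrT' x,
    (hρI r hr x).2.trans (le_max_of_le_left (le_max_right _ _)),
    (hCu r hr x).trans (le_max_of_le_right (le_max_left _ _)), ?_, ?_⟩
  · have h := hCθ r hr x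
    rw [Real.norm_eq_abs] at h
    exact ((le_abs_self _).trans h).trans (le_max_of_le_right (le_max_right _ _))
  · refine hZm _ ⟨(mul_pos (hE'.density_pos r hrT' x) hσ3).le, ?_⟩
    exact (mul_le_mul_of_nonneg_right (hρI r hr x).2 hσ3.le).trans (le_max_right _ _)

/-! ### The pointwise good/bad-ball alternative -/

/-- **The pointwise good/bad alternative** (pure real arithmetic). At a point with ball state
`(ρ', E')` (`≥ 0`), deviations `(a, b, c)` from the Euler state, ball rate `B`, Euler rate `E`:
if GOOD points (`|a| + b + |c| ≤ c₀ ≤ 1`) enjoy the quadratic remainder `|B − E| ≤ C_B dev²`,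
and everywhere `|B| ≤ A(ρ' + E' + c̃)`, `|E| ≤ C_E`, `c̃ ≤ 2L E' + tail`, then
`|B − E| ≤ (C_B + κ₀⁻¹(2A + C_E))(1 + L) · (1 + ρ' + E') min(1, dev²) + A · tail`,
`κ₀ = min(1, c₀²/3)`: on good points `dev² = min(1, dev²)`, on bad points
`min(1, dev²) ≥ κ₀`. [cite: Yau1991, §2] -/
theorem wb_pointwise {Bv Ev CB c₀ A CE L a b c ρ' E' cc tl : ℝ}
    (hc₀ : 0 < c₀) (hc₀1 : c₀ ≤ 1) (hCB : 0 ≤ CB) (hA : 0 ≤ A) (hCE : 0 ≤ CE) (hL : 1 ≤ L)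
    (hρ' : 0 ≤ ρ') (hE' : 0 ≤ E') (htl : 0 ≤ tl) (hb : 0 ≤ b)
    (hgood : |a| + b + |c| ≤ c₀ → |Bv - Ev| ≤ CB * (a ^ 2 + b ^ 2 + c ^ 2))
    (hball : |Bv| ≤ A * (ρ' + E' + cc)) (hEul : |Ev| ≤ CE) (hcub : cc ≤ 2 * L * E' + tl) :
    |Bv - Ev| ≤ (CB + (min 1 (c₀ ^ 2 / 3))⁻¹ * (2 * A + CE)) * (1 + L) *
        ((1 + ρ' + E') * min 1 (a ^ 2 + b ^ 2 + c ^ 2)) + A * tl := by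
  have hκ0 : 0 < min 1 (c₀ ^ 2 / 3) := lt_min one_pos (by positivity)
  have hD0 : 0 ≤ a ^ 2 + b ^ 2 + c ^ 2 := by positivity
  have hmin0 : 0 ≤ min 1 (a ^ 2 + b ^ 2 + c ^ 2) := le_min zero_le_one hD0
  have hw0 : (0 : ℝ) ≤ 1 + ρ' + E' := by linarith
  have hW : 0 ≤ (1 + ρ' + E') * min 1 (a ^ 2 + b ^ 2 + c ^ 2) := mul_nonneg hw0 hmin0
  have hX : 0 ≤ (min 1 (c₀ ^ 2 / 3))⁻¹ * (2 * A + CE) :=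
    mul_nonneg (inv_nonneg.2 hκ0.le) (by positivity)
  have hAtl : 0 ≤ A * tl := mul_nonneg hA htl
  have hL0 : 0 ≤ L := zero_le_one.trans hL
  have hsa : |a| ^ 2 = a ^ 2 := sq_abs a
  have hsc : |c| ^ 2 = c ^ 2 := sq_abs c
  by_cases hg : |a| + b + |c| ≤ c₀
  · -- good point: the quadratic remainder
    have h1 := hgood hg
    have hDle : a ^ 2 + b ^ 2 + c ^ 2 ≤ 1 := by
      have hS0 : 0 ≤ |a| + b + |c| := by positivity
      have h2 : a ^ 2 + b ^ 2 + c ^ 2 ≤ (|a| + b + |c|) ^ 2 := by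
        nlinarith [abs_nonneg a, abs_nonneg c, hb]
      have h3 : (|a| + b + |c|) ^ 2 ≤ 1 := by nlinarith
      linarith
    rw [min_eq_right hDle]
    have h2 : CB * (a ^ 2 + b ^ 2 + c ^ 2) ≤ CB * ((1 + ρ' + E') * (a ^ 2 + b ^ 2 + c ^ 2)) :=
      mul_le_mul_of_nonneg_left (le_mul_of_one_le_left hD0 (by linarith)) hCB
    have h3 : CB ≤ (CB + (min 1 (c₀ ^ 2 / 3))⁻¹ * (2 * A + CE)) * (1 + L) := by
      nlinarith [mul_nonneg hCB hL0, mul_nonneg hX hL0]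
    have h4 := mul_le_mul_of_nonneg_right h3 (mul_nonneg hw0 hD0)
    linarith
  · -- bad point: crude sizes, priced by `κ₀⁻¹ (1 + ρ' + E') min(1, dev²)`
    rw [not_le] at hg
    have hκD : min 1 (c₀ ^ 2 / 3) ≤ min 1 (a ^ 2 + b ^ 2 + c ^ 2) := by
      refine min_le_min_left 1 ?_
      have hS : (|a| + b + |c|) ^ 2 ≤ 3 * (a ^ 2 + b ^ 2 + c ^ 2) := by
        nlinarith [sq_nonneg (|a| - b), sq_nonneg (b - |c|), sq_nonneg (|a| - |c|)]
      have h2 : c₀ ^ 2 ≤ (|a| + b + |c|) ^ 2 := pow_le_pow_left₀ hc₀.le hg.le 2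
      linarith
    have hone : (1 : ℝ) ≤ (min 1 (c₀ ^ 2 / 3))⁻¹ * min 1 (a ^ 2 + b ^ 2 + c ^ 2) := by
      rw [le_inv_mul_iff₀ hκ0, mul_one]
      exact hκD
    have hsum : |Bv - Ev| ≤ A * (ρ' + E' + cc) + CE := (abs_sub _ _).trans (add_le_add hball hEul)
    have hAcc := mul_le_mul_of_nonneg_left hcub hA
    have hP : 0 ≤ 2 * A + CE := by positivity
    have h2 : A * (ρ' + E' + cc) + CE ≤ (2 * A + CE) * (1 + L) * (1 + ρ' + E') + A * tl := by
      nlinarith [mul_nonneg hP hL0, mul_nonneg (mul_nonneg hP hL0) hρ', mul_nonneg hA hρ',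
        mul_nonneg hCE hρ', mul_nonneg hCE hE', mul_nonneg hA hE',
        mul_nonneg (mul_nonneg hCE hL0) hE']
    have h3 : (2 * A + CE) * (1 + L) * (1 + ρ' + E') ≤ (2 * A + CE) * (1 + L) *
        ((min 1 (c₀ ^ 2 / 3))⁻¹ * ((1 + ρ' + E') * min 1 (a ^ 2 + b ^ 2 + c ^ 2))) := by
      refine mul_le_mul_of_nonneg_left ?_ (by positivity)
      have h := mul_le_mul_of_nonneg_left hone hw0
      linarith [h, (by ring : (1 + ρ' + E') * ((min 1 (c₀ ^ 2 / 3))⁻¹ *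
        min 1 (a ^ 2 + b ^ 2 + c ^ 2)) =
        (min 1 (c₀ ^ 2 / 3))⁻¹ * ((1 + ρ' + E') * min 1 (a ^ 2 + b ^ 2 + c ^ 2)))]
    have h4 : (2 * A + CE) * (1 + L) *
        ((min 1 (c₀ ^ 2 / 3))⁻¹ * ((1 + ρ' + E') * min 1 (a ^ 2 + b ^ 2 + c ^ 2))) ≤
        (CB + (min 1 (c₀ ^ 2 / 3))⁻¹ * (2 * A + CE)) * (1 + L) *
          ((1 + ρ' + E') * min 1 (a ^ 2 + b ^ 2 + c ^ 2)) := by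
      have heq : (2 * A + CE) * (1 + L) *
          ((min 1 (c₀ ^ 2 / 3))⁻¹ * ((1 + ρ' + E') * min 1 (a ^ 2 + b ^ 2 + c ^ 2))) =
          ((min 1 (c₀ ^ 2 / 3))⁻¹ * (2 * A + CE)) * (1 + L) *
            ((1 + ρ' + E') * min 1 (a ^ 2 + b ^ 2 + c ^ 2)) := by ring
      rw [heq]
      refine mul_le_mul_of_nonneg_right (mul_le_mul_of_nonneg_right (by linarith) (by linarith)) hW
    linarith [hsum, h2, h3, h4, hAtl]

/-! ### The registered stub -/

/-- **The flux-remainder integral bound** (registered stub `integral_abs_ballRate_sub_eulerRate_le`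
of crux stmt-AtomisticToContinuum-12502, line `small-tilt-domination`). Along a classical
hard-sphere Euler solution with packing `< η₀` on `[0, t] × 𝕋³` and for configurations obeying the
ball-packing cap `ρ̃σ³ ≤ η₁ < η₀`, the entropy rate at the ball averages and at the Euler state are
integrable in the centre and `∫ |ballRate − eulerRate| dx ≤ C(1 + L)·fluctuationE + C·cubicTail L`
with `C` depending on the solution data only: on GOOD balls (deviation `≤ c₀`) Dafermos' quadratic
remainder `entropyFlux_remainder_bound` is `≤ C_B dev² = C_B min(1, dev²)`; on BAD balls the crude
sizes `|ballRate| ≤ C(ρ̃ + ẽ + c̃)`, `|eulerRate| ≤ C_E`, `c̃ ≤ 2Lẽ + n⁻¹Σkᵢ‖vᵢ‖³𝟙{‖vᵢ‖>L}` are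
priced by `min(1, dev²) ≥ min(1, c₀²/3)` and the unit mass of the ball kernel
(`∫ tail = cubicTail`). [cite: Yau1991, §2] -/
theorem integral_abs_ballRate_sub_eulerRate_le : ∀ {η₀ : ℝ} {F : ℝ → ℝ}, 0 < η₀ → AnalyticOnNhd ℝ F (Set.Ioo (-η₀) η₀) → Set.EqOn hsExcessFreeEnergy F (Set.Ico 0 η₀) → ∀ {σ T : ℝ}, 0 < σ → ∀ {ρ θ : ℝ → T3 → ℝ} {u : ℝ → T3 → V3}, IsHardSphereEulerSolution σ T ρ u θ → ∀ {t : ℝ}, t ∈ Set.Ico 0 T → (∀ s ∈ Set.Icc 0 t, ∀ x, ρ s x * σ ^ 3 < η₀) → ∀ {η₁ : ℝ}, 0 < η₁ → η₁ < η₀ → ∃ C : ℝ, 0 < C ∧ ∀ r ∈ Set.Icc 0 t, ∀ {ℓ : ℝ}, 0 < ℓ → ℓ < 1 / 2 → ∀ {L : ℝ}, 1 ≤ L → ∀ {n : ℕ} (w : Config n (Fin 3) T3), (∀ x, empiricalDensityField w (ballKernel ℓ x) * σ ^ 3 ≤ η₁) → Integrable (fun x => ballRate σ T ρ θ u r ℓ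 w x) ∧ Integrable (fun x => eulerRate σ T ρ θ u r x) ∧ ∫ x, |ballRate σ T ρ θ u r ℓ w x - eulerRate σ T ρ θ u r x| ≤ C * (1 + L) * fluctuationE ℓ (ρ r) (θ r) (u r) w + C * cubicTail L w := by
  intro η₀ F hη₀ hFa hF σ T hσ ρ θ u hE t ht hpack η₁ hη₁ hη₁₀
  have hσ3 : 0 < σ ^ 3 := pow_pos hσ 3
  -- (i) data of the solution on `[0, t] × 𝕋³`
  obtain ⟨Λ, hΛ0, hcoef⟩ := wb_coeffs hη₀ hFa hF hσ hE ht hpack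
  obtain ⟨Ls, hLs, Zm, hZm0, hZcap, hsol⟩ := wb_solution_bounds hη₀ hFa hF hσ hE ht hpack hη₁₀
  obtain ⟨CB, hCB0, c₀, hc₀0, hrem⟩ := entropyFlux_remainder_bound hη₀ hFa hF hσ hE t ht hpack
  -- (ii) the constants
  obtain ⟨A, hA⟩ : ∃ A : ℝ, A = Λ * (25 + 6 * Zm) := ⟨_, rfl⟩
  obtain ⟨CE, hCE⟩ : ∃ CE : ℝ, CE = Λ * (25 + 6 * Zm) * (7 * Ls ^ 4) := ⟨_, rfl⟩
  obtain ⟨c₁, hc₁⟩ : ∃ c₁ : ℝ, c₁ = min c₀ 1 := ⟨_, rfl⟩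
  obtain ⟨K₁, hK₁⟩ : ∃ K₁ : ℝ, K₁ = CB + (min 1 (c₁ ^ 2 / 3))⁻¹ * (2 * A + CE) := ⟨_, rfl⟩
  have hA0 : 0 ≤ A := by rw [hA]; positivity
  have hCE0 : 0 ≤ CE := by rw [hCE]; positivity
  have hc₁0 : 0 < c₁ := by rw [hc₁]; exact lt_min hc₀0 one_pos
  have hc₁1 : c₁ ≤ 1 := by rw [hc₁]; exact min_le_right _ _
  have hc₁c : c₁ ≤ c₀ := by rw [hc₁]; exact min_le_left _ _
  have hK₁0 : 0 ≤ K₁ := by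
    rw [hK₁]
    exact add_nonneg hCB0.le (mul_nonneg (inv_nonneg.2 (lt_min one_pos (by positivity)).le)
      (by positivity))
  refine ⟨K₁ + A + 1, by linarith, ?_⟩
  intro r hr ℓ hℓ0 hℓ L hL n w hcap
  obtain ⟨hbd, m0, m1, m4, q0, q1, q4⟩ := hcoef r hr
  have hrT : r ∈ Set.Ico 0 T := ⟨hr.1, hr.2.trans_lt ht.2⟩
  have hL0 : 0 ≤ L := zero_le_one.trans hL
  obtain ⟨mρ, mm, me⟩ := wb_measurable_ballFields ℓ w
  have cρ : Continuous (ρ r) := (hE.smooth_density.isSmooth_slice hrT).continuous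
  have cu : Continuous (u r) := (hE.smooth_velocity.isSmooth_slice hrT).continuous
  have cθ : Continuous (θ r) := (hE.smooth_temperature.isSmooth_slice hrT).continuous
  have cEn : Continuous fun x => totalEnergyDensity (ρ r x) (u r x) (θ r x) := by
    unfold totalEnergyDensity; fun_prop
  -- (iii) integrability of `ballRate`
  have hBallM : Measurable fun x => ballRate σ T ρ θ u r ℓ w x := by
    unfold ballRate; exact wb_measurable_entropyRate m0 m1 m4 q0 q1 q4 mρ me mm
  have hBallBd : ∀ x, |ballRate σ T ρ θ u r ℓ w x| ≤ A * (empiricalDensityField w (ballKernel ℓ x) +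
      empiricalEnergyField w (ballKernel ℓ x) + (n : ℝ)⁻¹ * ∑ i, ballKernel ℓ x (w i).1 * ‖(w i).2‖ ^ 3) := by
    intro x
    obtain ⟨b0, b1, b4, b5, b6, b7⟩ := hbd x
    rw [hA]
    exact wb_abs_ballRate_le b0 b1 b4 b5 b6 b7 hZm0 ℓ w
      (hZcap _ ⟨mul_nonneg (ballDensity_nonneg ℓ x w) hσ3.le, hcap x⟩)
  have hIρ : Integrable fun x => empiricalDensityField w (ballKernel ℓ x) := by
    simpa using integrable_mul_ballDensity ℓ (continuous_const (y := (1 : ℝ))) w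
  have hIe : Integrable fun x => empiricalEnergyField w (ballKernel ℓ x) := by
    simpa using integrable_mul_ballEnergy ℓ (continuous_const (y := (1 : ℝ))) w
  have hIc := (wb_integrable_ballAverage ℓ w fun v => ‖v‖ ^ 3).2
  have hBallI : Integrable fun x => ballRate σ T ρ θ u r ℓ w x :=
    (((hIρ.add hIe).add hIc).const_mul A).mono' hBallM.aestronglyMeasurable
      (ae_of_all _ fun x => by rw [Real.norm_eq_abs]; exact hBallBd x)
  -- (iv) integrability of `eulerRate`
  have hEulM : Measurable fun x => eulerRate σ T ρ θ u r x := by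
    unfold eulerRate
    exact wb_measurable_entropyRate m0 m1 m4 q0 q1 q4 cρ.measurable cEn.measurable
      (cρ.smul cu).measurable
  have hEulBd : ∀ x, |eulerRate σ T ρ θ u r x| ≤ CE := fun x => by
    obtain ⟨b0, b1, b4, b5, b6, b7⟩ := hbd x
    obtain ⟨hρ0, hθ0, hρL, huL, hθL, hZ⟩ := hsol r hr x
    rw [hCE]
    exact wb_abs_eulerRate_le b0 b1 b4 b5 b6 b7 hZm0 hLs hρ0 hθ0 hρL huL hθL hZ
  have hEulI : Integrable fun x => eulerRate σ T ρ θ u r x :=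
    Integrable.of_bound hEulM.aestronglyMeasurable CE
      (ae_of_all _ fun x => by rw [Real.norm_eq_abs]; exact hEulBd x)
  refine ⟨hBallI, hEulI, ?_⟩
  -- (v) the two prices and the pointwise bound
  obtain ⟨φ, hφ⟩ : ∃ φ : T3 → ℝ, φ = fun x => (1 + empiricalDensityField w (ballKernel ℓ x) +
      empiricalEnergyField w (ballKernel ℓ x)) *
        min 1 ((empiricalDensityField w (ballKernel ℓ x) - ρ r x) ^ 2 +
          ‖empiricalMomentumField w (ballKernel ℓ x) - ρ r x • u r x‖ ^ 2 +
          (empiricalEnergyField w (ballKernel ℓ x) - totalEnergyDensity (ρ r x) (u r x) (θ r x)) ^ 2) :=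
    ⟨_, rfl⟩
  obtain ⟨τ, hτ⟩ : ∃ τ : T3 → ℝ, τ = fun x => (n : ℝ)⁻¹ * ∑ i, ballKernel ℓ x (w i).1 *
      Set.indicator {v : V3 | L < ‖v‖} (fun v => ‖v‖ ^ 3) (w i).2 := ⟨_, rfl⟩
  have hτ0 : ∀ x, 0 ≤ τ x := fun x => by
    rw [hτ]
    exact mul_nonneg (inv_nonneg.2 (Nat.cast_nonneg _)) (Finset.sum_nonneg fun i _ =>
      mul_nonneg (ballKernel_nonneg _ _ _) (Set.indicator_nonneg (fun v _ => by positivity) _))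
  have hpt : ∀ x, |ballRate σ T ρ θ u r ℓ w x - eulerRate σ T ρ θ u r x| ≤
      K₁ * (1 + L) * φ x + A * τ x := by
    intro x
    obtain ⟨hρ0, -, -, -, -, -⟩ := hsol r hr x
    have htl := hτ0 x
    rw [hτ] at htl ⊢
    rw [hφ, hK₁]
    dsimp only
    refine wb_pointwise hc₁0 hc₁1 hCB0.le hA0 hCE0 hL (ballDensity_nonneg ℓ x w)
      (ballEnergy_nonneg ℓ x w) htl (norm_nonneg _) (fun hS => ?_) (hBallBd x) (hEulBd x)
      (ballCubic_le_trunc ℓ x w hL0)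
    have h := hrem r hr x (empiricalDensityField w (ballKernel ℓ x))
      (empiricalEnergyField w (ballKernel ℓ x)) (empiricalMomentumField w (ballKernel ℓ x))
      (hS.trans hc₁c)
    simp only [] at h
    show |entropyRate σ T ρ θ u r x _ _ _ - eulerRate σ T ρ θ u r x| ≤ _
    rw [entropyRate_sub_eulerRate_eq hρ0.ne']
    exact h
  -- (vi) integrate
  have hφM : Measurable φ := by
    rw [hφ]
    exact ((measurable_const.add mρ).add me).mul (measurable_const.min
      ((((mρ.sub cρ.measurable).pow_const 2).add
        ((mm.sub (cρ.smul cu).measurable).norm.pow_const 2)).add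
        ((me.sub cEn.measurable).pow_const 2)))
  have hφI : Integrable φ := by
    have hg : Integrable fun x => 1 + empiricalDensityField w (ballKernel ℓ x) +
        empiricalEnergyField w (ballKernel ℓ x) := ((integrable_const (1 : ℝ)).add hIρ).add hIe
    refine hg.mono' hφM.aestronglyMeasurable (ae_of_all _ fun x => ?_)
    have h1 : 0 ≤ 1 + empiricalDensityField w (ballKernel ℓ x) + empiricalEnergyField w (ballKernel ℓ x) := by
      linarith [ballDensity_nonneg ℓ x w, ballEnergy_nonneg ℓ x w]
    rw [hφ]
    dsimp only
    rw [Real.norm_eq_abs, abs_mul, abs_of_nonneg h1, abs_of_nonneg (le_min zero_le_one (by positivity))]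
    simpa using mul_le_mul_of_nonneg_left (min_le_left (1 : ℝ) _) h1
  have hτI : Integrable τ := by
    rw [hτ]
    exact (wb_integrable_ballAverage ℓ w fun v => Set.indicator {v : V3 | L < ‖v‖} (fun v => ‖v‖ ^ 3) v).2
  have hRHS : Integrable fun x => K₁ * (1 + L) * φ x + A * τ x :=
    (hφI.const_mul (K₁ * (1 + L))).add (hτI.const_mul A)
  have hint : ∫ x, |ballRate σ T ρ θ u r ℓ w x - eulerRate σ T ρ θ u r x| ≤
      ∫ x, (K₁ * (1 + L) * φ x + A * τ x) :=
    integral_mono_of_nonneg (ae_of_all _ fun x => abs_nonneg _) hRHS (ae_of_all _ hpt)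
  rw [integral_add (hφI.const_mul _) (hτI.const_mul _), integral_const_mul, integral_const_mul]
    at hint
  have hflφ : ∫ x, φ x = fluctuationE ℓ (ρ r) (θ r) (u r) w := by rw [hφ]; rfl
  have hτc : ∫ x, τ x = cubicTail L w := by
    rw [hτ]
    exact integral_ballAverage_eq hℓ0 hℓ (fun v => Set.indicator {v : V3 | L < ‖v‖} (fun v => ‖v‖ ^ 3) v) w
  rw [hflφ, hτc] at hint
  refine hint.trans ?_
  have hF0 := fluctuationE_nonneg ℓ (ρ r) (θ r) (u r) w
  have hT0 : 0 ≤ cubicTail L w := by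
    rw [← hτc]
    exact integral_nonneg hτ0
  nlinarith [mul_nonneg (mul_nonneg (by linarith : (0 : ℝ) ≤ A + 1) (by linarith : (0 : ℝ) ≤ 1 + L)) hF0,
    mul_nonneg (by linarith : (0 : ℝ) ≤ K₁ + 1) hT0]

end Summit.AtomisticToContinuum.HydrodynamicLimit.Theorems.NearConstantShortTimeHL

end
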